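import Mathlib
import Summits.ResolutionOfSingularities.ResolutionOfSingularities.Theorems.WeightedInvariantLocalWeightedDropNCResRegimeDefs
import Summits.ResolutionOfSingularities.ResolutionOfSingularities.Theorems.WeightedInvariantLocalWeightedDropPolyDescentSelDefs
import Summits.ResolutionOfSingularities.ResolutionOfSingularities.Theorems.WeightedInvariantLocalWeightedDropNCPolyBridgeExit

/-!
# `LocalWeightedDrop`, TOT2-LINE inner S-ASM (4): PRESENTATIONS of a decorated state by a label of the polyhedron game, and the SUCCESSOR
# FAMILIES of Σ**_d with their boundary bookkeeping (definitions)

Crux item stmt-ResolutionOfSingularities-8899 `WeightedInvariant.LocalWeightedDrop` (route `ResolutionOfSingularities/WeightedInvariant`), ENGINE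
skeleton v33 (35b29332b4d99231), registered stub `stub_regimePresented` (regime (P) of the `o ≥ 2` head phase); TOT2-LINE v1.3 §3 (P1)–(P4)
(`L/res-L1-w43-lead-1/g5/TOT2-LINE-v1.3.md`).  [OURS · L1 W4.3 · chain w43 · seat res-L1-w43-lead-1 gen 5; the INTERFACES between the hands of regime
(P): res-L1-w43-stub-2's δ-adapter (presentations `Θ^*(f·∏_O x_l) = U·(y^d + Σ A_j y^j)` with the boundary straightened, …TOT2BridgeDecorated…),
res-type-088's conflict budget (label + coordinate boundary `N ⊆ {u₁,u₂}`, successor boundaries of `NCPoly.pointMove_of_represents` /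
`TOT2Curve.succMove_of_represents_bdry`), stub-2's selector strategies `PolyDescent.succTSel` (p538100); nothing here is a statement of any
manuscript; AI-produced, gate-checked, weaker than expert review.]

* `TameFourTupleDrop.Decoration.PresBy δ d A N Θ` — `Θ` is a legal coordinate change, point-B-permissible for `δ` (so it straightens every boundary
  letter), sending the history letters to the last axis `y` and the other boundary letters onto EXACTLY the `u`-axes listed in `N ⊆ Fin 2`, with
  `Θ^*(f · ∏_{l∈O} x_l) = U · monicGerm d A`, `U(0) ≠ 0`;
* `PolyDescent.PointFamilySel d ψsel A N A′ N′` — `(A′, N′)` is one of the three point-move successors of `(A, N)` with its boundary (origin of the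
  `u₁`-chart / translated `u₁`-chart point with the selected preparation / origin of the `u₂`-chart);
* `PolyDescent.SuccFamilySel d ψsel A N A′ N′` — `(A′, N′)` is the successor of `(A, N)` under the selector strategy `succTSel d ψsel` with its boundary
  (curve `V(y,u₁)` / curve `V(y,u₂)` / graph curve off the conflict `u₂ ∉ N` / point family), side conditions as in the strategy;
* `PolyDescent.mem_succTSel_of_succFamilySel` — a family successor is a strategy successor.
-/

set_option linter.dupNamespace false -- mandated namespace of this single-conjunct summit

noncomputable section

namespace Summit.ResolutionOfSingularities.ResolutionOfSingularities.Theorems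

open Literature.AlgebraicGeometry.Resolution

namespace TameFourTupleDrop

open MvPowerSeries

variable {k : Type} [Field k]

/-- `Θ` PRESENTS the decorated state `δ` (three letters) by the label `A` of degree `d` with `u`-boundary `N`: `Θ` is point-B-permissible for `δ`
(legal, every boundary letter straightened), the history letters go to the last axis `y = x₂`, the other boundary letters go onto exactly the `u`-axes
`x_{j}`, `j ∈ N`, and `Θ^*(f · ∏_{l ∈ O} x_l) = U · (y^d + Σ_j A_j(u) y^j)` for a unit `U`. -/
def Decoration.PresBy (δ : Decoration k 2) (d : ℕ) (A : Fin d → MvPowerSeries (Fin 2) k) (N : Finset (Fin 2))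
    (Θ : Fin 3 → MvPowerSeries (Fin 3) k) : Prop :=
  IsBPermissible δ Θ (fun _ => 1) ∧
    (∀ l ∈ δ.O, strIdx Θ l = Fin.last 2) ∧
    (∀ l ∈ δ.E, l ∉ δ.O → ∃ j ∈ N, strIdx Θ l = Fin.castSucc j) ∧
    (∀ j ∈ N, ∃ l ∈ δ.E, l ∉ δ.O ∧ strIdx Θ l = Fin.castSucc j) ∧
    ∃ U : MvPowerSeries (Fin 3) k, constantCoeff U ≠ 0 ∧ subst Θ (δ.f * ∏ l ∈ δ.O, X l) = U * NCPoly.monicGerm d A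

end TameFourTupleDrop

namespace PolyDescent

open MvPowerSeries WildMonic

variable {k : Type} [Field k]

/-- THE POINT-MOVE SUCCESSORS of `(A, N)` with their coordinate boundaries: origin of the `u₁`-chart (exceptional letter `u₁`, the letter `u₂` passes),
the point `c ≠ 0` of the exceptional line read in the `u₁`-chart after the shear by `c` and the selected preparation (only the exceptional letter
passes), origin of the `u₂`-chart (exceptional letter `u₂`, the letter `u₁` passes). -/
def PointFamilySel (d : ℕ) (ψsel : (Fin d → MvPowerSeries (Fin 2) k) → MvPowerSeries (Fin 2) k)
    (A : Fin d → MvPowerSeries (Fin 2) k) (N : Finset (Fin 2)) (A' : Fin d → MvPowerSeries (Fin 2) k) (N' : Finset (Fin 2)) : Prop :=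
  (A' = blowOneT d A ∧ N' = insert 0 (N.filter fun l => l = 1)) ∨
    (∃ c : k, c ≠ 0 ∧ A' = blowOneT d (shift d (shearT (C c) A) (ψsel (shearT (C c) A))) ∧ N' = {0}) ∨
    (A' = blowTwoT d A ∧ N' = insert 1 (N.filter fun l => l = 0))

/-- THE SUCCESSORS OF `(A, N)` UNDER THE SELECTOR STRATEGY `succTSel d ψsel` with their coordinate boundaries and side conditions: the curve
`V(y,u₁)`; else the curve `V(y,u₂)`; else a graph curve, OFF the conflict (`u₂ ∉ N`); else the point family. -/
def SuccFamilySel (d : ℕ) (ψsel : (Fin d → MvPowerSeries (Fin 2) k) → MvPowerSeries (Fin 2) k)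
    (A : Fin d → MvPowerSeries (Fin 2) k) (N : Finset (Fin 2)) (A' : Fin d → MvPowerSeries (Fin 2) k) (N' : Finset (Fin 2)) : Prop :=
  (IsPermissibleOneT d A ∧ A' = divOneT d A ∧ N' = insert 0 (N.filter fun l => l = 1)) ∨
    (¬ IsPermissibleOneT d A ∧ IsPermissibleTwoT d A ∧ A' = divTwoT d A ∧ N' = insert 1 (N.filter fun l => l = 0)) ∨
    (¬ IsPermissibleOneT d A ∧ ¬ IsPermissibleTwoT d A ∧ HasGraphCurveT d A ∧ (1 : Fin 2) ∉ N ∧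
      A' = divTwoT d (shift d (shearT (graphShearT d A) A) (ψsel (shearT (graphShearT d A) A))) ∧ N' = insert 1 (N.filter fun l => l = 0)) ∨
    (¬ IsPermissibleOneT d A ∧ ¬ IsPermissibleTwoT d A ∧ ¬ HasGraphCurveT d A ∧ PointFamilySel d ψsel A N A' N')

/-- A family successor is a successor of the selector strategy. -/
theorem mem_succTSel_of_succFamilySel {d : ℕ} {ψsel : (Fin d → MvPowerSeries (Fin 2) k) → MvPowerSeries (Fin 2) k}
    {A A' : Fin d → MvPowerSeries (Fin 2) k} {N N' : Finset (Fin 2)} (h : SuccFamilySel d ψsel A N A' N') : A' ∈ succTSel d ψsel A := by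
  rcases h with ⟨h1, rfl, -⟩ | ⟨h1, h2, rfl, -⟩ | ⟨h1, h2, h3, -, rfl, -⟩ | ⟨h1, h2, h3, hpt⟩
  · rw [succTSel_of_isPermissibleOneT ψsel h1]; exact Set.mem_singleton _
  · rw [succTSel_of_isPermissibleTwoT ψsel h1 h2]; exact Set.mem_singleton _
  · rw [succTSel_of_hasGraphCurveT ψsel h1 h2 h3]; exact Set.mem_singleton _
  · rw [succTSel_of_point ψsel h1 h2 h3]
    rcases hpt with ⟨rfl, -⟩ | ⟨c, hc, rfl, -⟩ | ⟨rfl, -⟩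
    · exact Or.inl (Or.inl rfl)
    · exact Or.inr ⟨c, hc, rfl⟩
    · exact Or.inl (Or.inr rfl)

/-- A family successor off the conflict is not taken at a conflict state (the conflict state has `u₂ ∈ N` and a graph step). -/
theorem not_conflict_of_succFamilySel {d : ℕ} {ψsel : (Fin d → MvPowerSeries (Fin 2) k) → MvPowerSeries (Fin 2) k}
    {A A' : Fin d → MvPowerSeries (Fin 2) k} {N N' : Finset (Fin 2)} (h : SuccFamilySel d ψsel A N A' N') : ¬ NCPoly.Conflict d A N := by
  rintro ⟨h1, h2, h3, hN⟩
  rcases h with ⟨h1', -⟩ | ⟨-, h2', -⟩ | ⟨-, -, -, hN', -⟩ | ⟨-, -, h3', -⟩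
  · exact h1 h1'
  · exact h2 h2'
  · exact hN' hN
  · exact h3' h3

end PolyDescent

end Summit.ResolutionOfSingularities.ResolutionOfSingularities.Theorems

end
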